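import Summits.QuantumFields.QCD.Theses.QuarksAsStableAction
import Literature.MathematicalPhysics.QuantumLattice.WilsonDiracAP
import Literature.MathematicalPhysics.QuantumFieldTheory.WilsonSiteRPForm
import Summits.QuantumFields.QCD.Theorems.QuarksAsStableActionUnquenchedChessboardBoundStubDetBound
import Summits.QuantumFields.QCD.Theorems.QuarksAsStableActionUnquenchedChessboardBoundHeavyFloor
import Summits.QuantumFields.QCD.Theorems.QuarksAsStableActionUnquenchedChessboardBoundStubGaugeFloor
import Summits.QuantumFields.QCD.Theorems.QuarksAsStableActionUnquenchedChessboardBoundStubChessboard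
import Summits.QuantumFields.QCD.Theorems.QuarksAsStableActionUnquenchedChessboardBoundStubAxisSwap
import Summits.QuantumFields.QCD.Theorems.QuarksAsStableActionDefs
import Summits.QuantumFields.QCD.Theorems.QuarksAsStableActionUnquenchedChessboardBoundStubShiftZb
import Summits.QuantumFields.QCD.Theorems.QuarksAsStableActionUnquenchedChessboardBoundStubTemporalGauge
import Summits.QuantumFields.QCD.Theorems.QuarksAsStableActionUnquenchedChessboardBoundStubMarginalRP
import Summits.QuantumFields.QCD.Theorems.QuarksAsStableActionUnquenchedChessboardBoundPeelFloor
import Summits.QuantumFields.QCD.Theorems.QuarksAsStableActionUnquenchedChessboardBoundStubAssembly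
import Summits.QuantumFields.QCD.Theorems.QuarksAsStableActionUnquenchedChessboardBoundStubSitePeel
import Summits.QuantumFields.QCD.Theorems.QuarksAsStableActionUnquenchedChessboardBoundStubLinkGram
import Literature.MathematicalPhysics.QuantumFieldTheory.ConstructiveQFTWave0Proofs

/-!
# The crux `UnquenchedChessboardBound` (stmt-QuantumFields-9735), line `Sketch`

The unquenched chessboard estimate for lattice QCD with `N_f` Wilson quarks at strong enough coupling:
for every mass window `⊂ (-1, ∞)` and defect threshold `δ > 0` there are `C, c > 0, β₀` such that for
all `β ≥ β₀` and all even `L ≥ 4`, the det-weighted Wilson expectation of the event "every plaquette of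
`R` has defect `≥ δ`" is at most `(C e^{-cβ})^{|R|}`.

Composition (`UnquenchedChessboardBound_of`) of the landed inputs of the line:
* `stub_detBound` (Hadamard bound on `det D_AP`), `stub_gaugeFloor` (pure-gauge entropy floor),
  `stub_chessboard` (abstract four-axis chessboard estimate in letter form), `stub_marginalRP`
  (marginal site-reflection positivity of the signed det-weighted functional), `stub_axisSwap`
  (hypercubic covariance), `stub_assembly` (dissemination bookkeeping) — imported;
* `stub_signedFloor` (floor `Re ∫ ∏_f det D_AP e^{-βS_W} ≥ e^{-(a+εβ)L⁴}` on the signed partition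
  function), proved here from the peeling recursion `signedFloor_of_peels` and the four peels:
  `stub_torusPeel`, `stub_sitePeel` (site reflections, imported), `stub_linkPeel` (below, from the
  temporal gauge `stub_temporalGauge` and the link Gram inequality `stub_linkGram`) and the
  translation covariance `stub_shiftZb`.
All statements are proved.
-/

noncomputable section

open MeasureTheory Matrix Complex Finset
open Literature.MathematicalPhysics.QuantumFieldTheory Literature.MathematicalPhysics.QuantumLattice
open Summit.QuantumFields.QCD.Theorems.QuarksAsStableAction
open scoped ComplexConjugate BigOperators ComplexOrder

namespace Summit.QuantumFields.QCD.Theorems.UnquenchedChessboardBoundLine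

/-! ## Stub 1 — pathwise determinant bound (Hadamard): LANDED
`stub_detBound` is imported from `QuarksAsStableActionUnquenchedChessboardBoundStubDetBound` (p103173, wave 1). -/

/-! ## Stub 2 — pure-gauge entropy floor (Haar small ball): LANDED
`stub_gaugeFloor` is imported from `QuarksAsStableActionUnquenchedChessboardBoundStubGaugeFloor` (p103687, wave 1). -/

/-! ## Stub 3 — the abstract chessboard estimate (letter form, every even period, four axes): LANDED
`stub_chessboard` is imported from `QuarksAsStableActionUnquenchedChessboardBoundStubChessboard`
(p103508 Aux + p104129, wave 1). -/

/-! ## Stub 4 — marginal site-reflection positivity of the signed functional (time axis): LANDED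
`stub_marginalRP` is imported from `QuarksAsStableActionUnquenchedChessboardBoundStubMarginalRP`
(p112220, wave 1/2, worker w-marginalRP: Gram identity of the chirality-split determinant + PSD shared
kernel + the tree's shared-block mechanism). -/

/-! ## Stub 5 — hypercubic covariance (time axis ↔ axis `i`): LANDED
`stub_axisSwap` is imported from `QuarksAsStableActionUnquenchedChessboardBoundStubAxisSwap`
(Aux + p105313, wave 1). -/

/-! ## Stub 6 — the floor on the SIGNED partition function (lead's stub)
`stub_signedFloor` = `signedFloor_of_peels hgauge stub_torusPeel stub_sitePeel stub_linkPeel stub_shiftZb`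
(peeling recursion `…PeelFloorAux`, `…PeelFloor`; peels `…StubSitePeel`, `…StubLinkGram`,
`…StubTemporalGauge`, `…StubShiftZb`; heavy window separately in `…HeavyFloor`). -/

/-- **`linkPeel`** from `stub_temporalGauge` + `stub_linkGram` (LINK reflection `t ↦ 1 - t` of the tree's `GaugeConfig.timeReflect`, in
the hyperplanes between the slices `0 | 1` and `L/2 | L/2 + 1`, `β ≥ 0`): the closed slab of the
slices `-p, …, p + 1` (odd length `2p + 1 ≤ L/2`) and its upper half `1, …, p + 1` satisfy
`0 ≤ Re Zb(slab[-p, p+1])` and `‖Zb(slab[1, p+1])‖² ≤ Re Zb(slab[-p, p+1]) · Re Zb(∅)` (the link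
Gram identity gives the entries `Zb(slab[1,p+1] ∪ layer 0→1)` and `Zb(layer 0→1)`, which equal
`Zb(slab[1,p+1])` and `Zb(∅)` because a temporal layer hanging on bare sites is transparent at the
level of determinants, `P₊ P₋ = 0`). -/
theorem stub_linkPeel (Nf L : ℕ) [NeZero L] [Fact (1 < L)] (hL : Even L) (h4 : 4 ≤ L) (β : ℝ)
    (hβ : 0 ≤ β) (m : Fin Nf → ℝ) (hm : ∀ f, -1 < m f) (p : ℕ) (hp : 2 * p + 1 ≤ L / 2) :
    0 ≤ (∫ U, (∏ f, (bondWilsonDiracAP (slabBonds (-(p : ZMod L)) (2 * p + 1)) U (m f)).det) *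
            (Real.exp (-β * wilsonAction (fundamentalRep (Fin 3)) U) : ℂ)
          ∂(Measure.pi fun _ : Edge 4 L => haarProbability (Matrix.specialUnitaryGroup (Fin 3) ℂ))).re ∧
      ‖∫ U, (∏ f, (bondWilsonDiracAP (slabBonds 1 p) U (m f)).det) *
            (Real.exp (-β * wilsonAction (fundamentalRep (Fin 3)) U) : ℂ)
          ∂(Measure.pi fun _ : Edge 4 L => haarProbability (Matrix.specialUnitaryGroup (Fin 3) ℂ))‖ ^ 2 ≤
        (∫ U, (∏ f, (bondWilsonDiracAP (slabBonds (-(p : ZMod L)) (2 * p + 1)) U (m f)).det) *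
            (Real.exp (-β * wilsonAction (fundamentalRep (Fin 3)) U) : ℂ)
          ∂(Measure.pi fun _ : Edge 4 L => haarProbability (Matrix.specialUnitaryGroup (Fin 3) ℂ))).re *
        (∫ U, (∏ f, (bondWilsonDiracAP ∅ U (m f)).det) *
            (Real.exp (-β * wilsonAction (fundamentalRep (Fin 3)) U) : ℂ)
          ∂(Measure.pi fun _ : Edge 4 L => haarProbability (Matrix.specialUnitaryGroup (Fin 3) ℂ))).re := by
  obtain ⟨h0, hcs⟩ := stub_linkGram Nf L hL h4 β hβ m hm p hp
  rw [stub_temporalGauge Nf L h4 β m (slabBonds (-(p : ZMod L)) (2 * p + 1)),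
    stub_temporalGauge Nf L h4 β m (slabBonds 1 p), stub_temporalGauge Nf L h4 β m ∅]
  exact ⟨h0, hcs⟩

/-- **`signedFloor`** (the load-bearing analytic input). For every flavour number, mass window
`[m_lo, m_hi] ⊂ (-1, ∞)` and slack `ε > 0` there is `a` such that for all `β ≥ 0`, all even `L ≥ 4`
and all masses in the window, `Re ∫ ∏_f det D_AP[U, m_f] e^{-β S_W(U)} ∏ₑ dU_e ≥ exp(-(a + εβ) L⁴)`:
the peeling recursion (torus peel, alternating site/link peels with fixed reflection planes and
shift covariance, window floor on short slabs) applied to the pure-gauge floor `hgauge`. -/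
theorem stub_signedFloor
    (hgauge : ∀ ε : ℝ, 0 < ε → ∃ a : ℝ, ∀ β : ℝ, 0 ≤ β → ∀ (L : ℕ) [NeZero L],
      Real.exp (-((a + ε * β) * (L : ℝ) ^ 4)) ≤
        ∫ U, Real.exp (-β * wilsonAction (fundamentalRep (Fin 3)) U) ∂(Measure.pi fun _ : Edge 4 L => haarProbability (Matrix.specialUnitaryGroup (Fin 3) ℂ)))
    (Nf : ℕ) (mlo mhi ε : ℝ) (hmlo : -1 < mlo) (hε : 0 < ε) :
    ∃ a : ℝ, ∀ β : ℝ, 0 ≤ β → ∀ (L : ℕ) [NeZero L], Even L → 4 ≤ L → ∀ m : Fin Nf → ℝ,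
      (∀ f, mlo ≤ m f ∧ m f ≤ mhi) →
      Real.exp (-((a + ε * β) * (L : ℝ) ^ 4)) ≤
        (∫ U, (∏ f, (wilsonDiracAP U (m f)).det) * (Real.exp (-β * wilsonAction (fundamentalRep (Fin 3)) U) : ℂ)
          ∂(Measure.pi fun _ : Edge 4 L => haarProbability (Matrix.specialUnitaryGroup (Fin 3) ℂ))).re :=
  signedFloor_of_peels hgauge
    (fun Nf L _ _ hL h4 β m hm => stub_torusPeel Nf L hL h4 β m hm)
    (fun Nf L _ _ hL h4 β m hm p hp => stub_sitePeel Nf L hL h4 β m hm p hp)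
    (fun Nf L _ _ hL h4 β hβ m hm p hp => stub_linkPeel Nf L hL h4 β hβ m hm p hp)
    (fun Nf L _ _ β m a ℓ => stub_shiftZb Nf L β m a ℓ) Nf mlo mhi ε hmlo hε

/-! ## Stub 7 — dissemination bookkeeping (assembly): LANDED
`stub_assembly` is imported from `QuarksAsStableActionUnquenchedChessboardBoundStubAssembly` (p113400,
worker w-assembly; Aux1–Aux5 p103900, p105346, p111089, p111656, p112100). -/

/-! ## Composition -/

/-- **The crux from the stubs**: `UnquenchedChessboardBound` (stmt-QuantumFields-9735) follows from
`stub_detBound`, `stub_chessboard`, `stub_marginalRP`, `stub_axisSwap`, `stub_signedFloor` by the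
dissemination bookkeeping `stub_assembly` (`stub_gaugeFloor` enters through `stub_signedFloor`). -/
theorem UnquenchedChessboardBound_of :
    Summit.QuantumFields.QCD.Theses.QuarksAsStableAction.UnquenchedChessboardBound :=
  stub_assembly (fun U m => stub_detBound U m)
    (fun hN _ _ _ r hr hrc Φ hcyc hpos hcs => stub_chessboard hN r hr hrc Φ hcyc hpos hcs)
    (fun Nf L _ _ hL h4 β m hm F hF => stub_marginalRP Nf L hL h4 β m hm F hF)
    (fun i U m => stub_axisSwap i U m)
    (fun Nf mlo mhi ε hmlo hε => stub_signedFloor stub_gaugeFloor Nf mlo mhi ε hmlo hε)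

end Summit.QuantumFields.QCD.Theorems.UnquenchedChessboardBoundLine

end
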